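import Summits.NavierStokesRegularity.NavierStokesRegularity.Theorems.ExtremiserTransienceTwoThirdsAssembly
import Summits.NavierStokesRegularity.NavierStokesRegularity.Theorems.ExtremiserTransienceTwoThirdsNormalisedDefs
import HarnessLib

/-!
# Route `ExtremiserTransience`, crux `NearExtremalTransiencePerFlow` (stmt-NavierStokesRegularity-26567),
# LINE g10-1 «two_thirds» (ns-idea-10), stub S1a′ — BRICK 4b′: ASSEMBLY in the NORMALISED, LARGE-SCALE form

`--supports stmt-NavierStokesRegularity-26567` (helper; prover seat ns-net-p2 g12).  The normalised target `TypicalSelectionNormalised` (texts p726086;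
`→ TypicalSelectionLarge` by p726088) asks good balls only at the scales `i₁ ≤ i < m` and lives at height `1`, Taylor length `1`.  This is brick 4b
(`typicalSelection_of_uncovered_small`, p724691) in exactly that currency:

* `normalised_conclusion_of_uncovered_small` — for `w` with `IsAdm w 1 B`, `IsReg A w 1`, `lam w = 1`, `(κ⋆−ε)√Z√W ≤ J` (`ε ≤ ε₀(A,R,η)`), candidate
  good-centre sets `G i ⊆ {c : ∃ r ∈ [4^i, 2·4^i], IsGoodBall w c r (K/(i+1))}` and per-scale bounds `∫_{Θ ∩ U_i} ‖curl w‖² ≤ β i` for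
  `i₁ ≤ i < m` with `Σ_{i₁ ≤ i < m} β i < c₀·Z` (`Θ = {‖curl w‖ ≥ θ₀}`, `U_i = {y : ∀ c, dist c y < 4^i/2 → c ∉ G i}`): a thick good centre
  `x₀` with a good ball near it at every scale `i₁ ≤ i < m` — the conclusion of `TypicalSelectionNormalised` for this `w`.
So `TypicalSelectionNormalised` ⟸ (brick 2 ⇒ per-translate Chebyshev `typicality_abstract` p724236 ⇒ brick 4d `thickUncovered_le_of_lattice_average`
⇒ `β i`) for `i ≥ i₁(A, A_E)`.  HONEST FRAMING: bookkeeping; nothing about Navier–Stokes is proved; no summit is proved by a line. [folklore]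
-/

noncomputable section

open scoped Topology InnerProductSpace RealInnerProductSpace ENNReal ContDiff
open MeasureTheory Filter Set Metric
open Literature.Analysis.FluidPDE
open Summit.NavierStokesRegularity.NavierStokesRegularity.Theorems.DepletionLadder
open Summit.NavierStokesRegularity.NavierStokesRegularity.Theorems.DepletionLadder.KStar.HalfSpace
open Summit.NavierStokesRegularity.NavierStokesRegularity.Theorems.DepletionLadder.KStar.BangBang
open Summit.NavierStokesRegularity.NavierStokesRegularity.Theorems.NearExtremalTransiencePerFlow.LocalMaximiser

namespace Summit.NavierStokesRegularity.NavierStokesRegularity.Theorems.NearExtremalTransiencePerFlow.TwoThirds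

-- the problem directory repeats the summit name (`NavierStokesRegularity/NavierStokesRegularity`)
set_option linter.dupNamespace false
set_option linter.style.longLine false

/-- **Brick 4b′ — assembly, normalised large-scale form.**  See the module docstring. [folklore] -/
theorem normalised_conclusion_of_uncovered_small :
    ∀ A : ℕ → ℝ, (∀ j, 1 ≤ A j) → ∃ θ₀ c₀ : ℝ, 0 < θ₀ ∧ 0 < c₀ ∧ ∀ (R η : ℝ), 0 < R → 0 < η → ∃ ε₀ : ℝ, 0 < ε₀ ∧
    ∀ (w : E3 → E3) (B ε : ℝ), IsAdm w 1 B → IsReg A w 1 → 0 < Zen w → 0 < Wpa w → lam w = 1 → 0 ≤ ε → ε ≤ ε₀ →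
      (kStar - ε) * Real.sqrt (Zen w) * Real.sqrt (Wpa w) ≤ Jst w →
      ∀ (i₁ m : ℕ) (K : ℝ) (G : ℕ → Set E3) (β : ℕ → ℝ),
        (∀ i, i₁ ≤ i → i < m → G i ⊆ {c | ∃ r : ℝ, (4 : ℝ) ^ i ≤ r ∧ r ≤ 2 * (4 : ℝ) ^ i ∧ IsGoodBall w c r (K / (i + 1))}) →
        (∀ i, i₁ ≤ i → i < m → ∫ x in {x | θ₀ ≤ ‖curl w x‖} ∩ {y | ∀ c, dist c y < (4 : ℝ) ^ i / 2 → c ∉ G i},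
          ‖curl w x‖ ^ 2 ≤ β i) →
        (∑ i ∈ Finset.Ico i₁ m, β i) < c₀ * Zen w →
        ∃ x₀ : E3, θ₀ ≤ ‖curl w x₀‖ ∧
          (∀ φ : E3 → E3, IsTestAt w 1 φ → tsupport φ ⊆ Metric.ball x₀ R → locGain kStar 1 w φ ≤ η) ∧
          ∀ i : ℕ, i₁ ≤ i → i < m → ∃ (c : E3) (r : ℝ), dist c x₀ ≤ r / 2 ∧ (4 : ℝ) ^ i ≤ r ∧ r ≤ 2 * (4 : ℝ) ^ i ∧
            IsGoodBall w c r (K / (i + 1)) := by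
  intro A hA
  obtain ⟨θ₀, c₀, hθ₀, hc₀, h1⟩ := exists_thickGood_mem A hA
  refine ⟨θ₀, c₀, hθ₀, hc₀, fun R η hR hη => ?_⟩
  obtain ⟨ε₀, hε₀, h1'⟩ := h1 R η hR hη
  refine ⟨ε₀, hε₀, ?_⟩
  intro w B ε hadm hreg hZ hW hlam hε0 hε hext i₁ m K G β hG hβ hsum
  obtain ⟨hv, hdiv, hvM, hvB, h0, h1l, h2⟩ := id hadm
  have hv1 : ContDiff ℝ 1 w := hv.of_le (by norm_cast)
  have hv2 : ContDiff ℝ 2 w := hv.of_le (by norm_cast)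
  have hext' : (kStar - ε) * 1 * Real.sqrt (Zen w) * Real.sqrt (Wpa w) ≤ Jst w := by rw [mul_one]; exact hext
  -- the thick set (at `M = λ = 1`) and the uncovered sets
  set Θ : Set E3 := {x | θ₀ ≤ ‖curl w x‖} with hΘ
  have hΘm : MeasurableSet Θ := (isClosed_le continuous_const (continuous_curl hv1).norm).measurableSet
  have hΘeq : {x : E3 | θ₀ * 1 * (lam w)⁻¹ ≤ ‖curl w x‖} = Θ := by
    ext x; simp only [hΘ, mem_setOf_eq, hlam, inv_one, mul_one]
  set U : ℕ → Set E3 := fun i => {y | ∀ c, dist c y < (4 : ℝ) ^ i / 2 → c ∉ G i} with hU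
  have hUm : ∀ i, MeasurableSet (U i) := fun i => (isClosed_uncovered (G i) _).measurableSet
  -- the test set `Y = (⋃_{i₁ ≤ i < m} Θ ∩ U i)ᶜ`
  set X : Set E3 := ⋃ i ∈ Finset.Ico i₁ m, (Θ ∩ U i) with hX
  have hXm : MeasurableSet X := Finset.measurableSet_biUnion _ fun i _ => hΘm.inter (hUm i)
  have hω2 : Integrable (fun x => ‖curl w x‖ ^ 2) := (integrable_norm_curl_sq hv2 h1l).1
  have hXle : ∫ x in X, ‖curl w x‖ ^ 2 ≤ ∑ i ∈ Finset.Ico i₁ m, β i := by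
    refine (setIntegral_biUnion_finset_le hω2 (fun x => sq_nonneg _) (Finset.Ico i₁ m) (fun i => Θ ∩ U i)
      (fun i _ => hΘm.inter (hUm i))).trans ?_
    exact Finset.sum_le_sum fun i hi => hβ i (Finset.mem_Ico.1 hi).1 (Finset.mem_Ico.1 hi).2
  have hcompl : (∫ x in X, ‖curl w x‖ ^ 2) + ∫ x in Xᶜ, ‖curl w x‖ ^ 2 = Zen w := by
    unfold Zen; exact integral_add_compl hXm hω2
  have hYlarge : (1 - c₀) * Zen w < ∫ x in Xᶜ, ‖curl w x‖ ^ 2 := by nlinarith [hXle, hcompl, hsum]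
  -- brick 1 at `M = 1`: a thick good centre in `Y = Xᶜ`
  obtain ⟨x₀, hx₀Y, hthick, hgood⟩ := h1' w 1 B ε hadm hreg hZ hW hε0 hε hext' Xᶜ hXm.compl hYlarge
  have hthick' : θ₀ ≤ ‖curl w x₀‖ := by rw [hlam, inv_one, mul_one, mul_one] at hthick; exact hthick
  refine ⟨x₀, hthick', fun φ hφ hsub => ?_, fun i hi₁ hi => ?_⟩
  · have h := hgood φ hφ (by rw [hlam, mul_one]; exact hsub)
    rw [hlam, mul_one, one_pow, mul_one] at h
    exact h
  -- `x₀ ∈ Θ`, hence `x₀ ∉ U i`: some good centre within `4^i/2`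
  have hx₀Θ : x₀ ∈ Θ := hthick'
  have hx₀U : x₀ ∉ U i := by
    intro hxU
    exact hx₀Y (Set.mem_iUnion₂.2 ⟨i, Finset.mem_Ico.2 ⟨hi₁, hi⟩, hx₀Θ, hxU⟩)
  have hex : ∃ c, dist c x₀ < (4 : ℝ) ^ i / 2 ∧ c ∈ G i := by
    by_contra hne
    push Not at hne
    exact hx₀U fun c hc hcG => hne c hc hcG
  obtain ⟨c, hcd, hcG⟩ := hex
  obtain ⟨r, hr1, hr2, hgoodball⟩ := hG i hi₁ hi hcG
  exact ⟨c, r, by linarith, hr1, hr2, hgoodball⟩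

end Summit.NavierStokesRegularity.NavierStokesRegularity.Theorems.NearExtremalTransiencePerFlow.TwoThirds

end
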